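import Summits.RiemannHypothesis.RiemannHypothesis.Theorems.JensenPolynomialsFarGumbelXi0Remainder
import HarnessLib

/-!
# Route `JensenPolynomials`, crux `XiWindowZeroFreeRelFar` — stub S4 `stub_elementary` of the far-Gumbel line PROVED
(RH-FREE; cell rh-jensen, HUMAN RULING D-0040 / D-0074)

LINE 1 (D-0074 framing): elementary real/complex analysis about the objects of theory g8's far-Gumbel normal form
(`JensenPolynomialsFarGumbelDefs`); nothing here bears on the zeros of `ζ` or is progress toward RH.

`stub_elementary` (registered on `stmt-RiemannHypothesis-19465`, skeleton v3): for `M ≥ 2·10¹⁸`, the far mode `υ ≥ 189/20`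
(`4πe^{4υ}υ = 2M + 9υ`) and `‖z̃‖ ≤ 3502/10000`,
(i) `log farEnv + 2 ≤ farMain − (Λ/υ³ + 6)` and (ii) `farMain(z̃) − farMain(0) − farCubic(z̃) ≤ (M − ½)/150 + 1`.

Proof = the separated budget of the S4 design (eng-5 g3 / eng-6 g3, STATUS 12:31Z / 12:40Z): with `ε = 1/υ ≤ 20/189`,
`f(ξ₀)+1 = (H₀+1) + εH₁ + Rem`, `‖Rem‖ ≤ ε²/2` (`norm_farF_farXi0_sub_le`), the mode equation `Λ = (M−½)ε/2 + ε/4 + 9/4`, and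
`farMain(z̃) − farMain(0) − farCubic = (M−½)·Re[L − T₃L + (ε/2)(H₀+1 − T₃) + (ε²/2)(H₁ − T₃) + (ε/2)Rem] + (ε/4 + 9/4)(Re f + 1)
+ ½log‖1+z̃‖`, the certified disc constants `c₀ ≤ 47/10000` (`re_log_sub_cubic_le`), `c₁ ≤ 11/400` (`re_farH0_profile_le`),
`c₂ ≤ 29/1000` (`re_farH1_profile_le`) give `Re[…] ≤ 47/10000 + (ε/2)(11/400) + (ε²/2)(29/1000) + ε³/4 ≤ 1/150`, the `O(1)` terms
`≤ 1`; for (i), `Re f + 1 ≥ −3/40 − (11/50)ε − ε²/2 ≥ −0.105` (`le_re_farH0`, `norm_farH1_le`) so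
`Λ(Re f + 1 + 1/8 − ε³) + ½log‖1+z̃‖ − 8 ≥ Λ/60 − 9 ≥ 0` as `Λ = πe^{4υ} ≥ πe^{37.8} > 2000`.

WHAT THIS IS NOT: a lemma about explicit numbers; the hard stub of the line is S3 (`stub_laplaceFar`). Nothing here bears on RH.
-/

noncomputable section

open Complex Set Metric

-- D-0017: `Summit.RiemannHypothesis.RiemannHypothesis.…` duplicates the namespace BY DESIGN (single-problem summit).
set_option linter.dupNamespace false

namespace Summit.RiemannHypothesis.RiemannHypothesis.Theorems.JensenPolynomials.FarGumbel

open Summit.RiemannHypothesis.RiemannHypothesis.Theorems.JensenPolynomials.CoeffTable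

/-! ## 1. Two-sided size of `Re f(ξ₀) + 1` and the profile budget -/

/-- For `‖z‖ ≤ 3502/10000`, `0 < ε ≤ 20/189`:
`−3/40 − (11/50)ε − ε²/2 ≤ Re f(ξ₀;w,ε) + 1 ≤ 1/5 + (11/50)ε + ε²/2`. -/
theorem re_farF_add_one_bounds {z : ℂ} (hz : ‖z‖ ≤ (3502 / 10000 : ℝ)) {ε : ℝ} (hε0 : 0 < ε) (hε : ε ≤ 20 / 189) :
    -3 / 40 - 11 / 50 * ε - ε ^ 2 / 2 ≤ (farF (farW z) ε (farXi0 (farW z) ε)).re + 1 ∧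
      (farF (farW z) ε (farXi0 (farW z) ε)).re + 1 ≤ 1 / 5 + 11 / 50 * ε + ε ^ 2 / 2 := by
  set Rem := farF (farW z) ε (farXi0 (farW z) ε) + 1 - (z - Complex.log (1 + z)) / (1 + z) -
    (ε : ℂ) * (Complex.log (1 + z) ^ 2 * ((1 + z)⁻¹ / 8 - (1 + z)⁻¹ ^ 2 / 4)) with hRem
  have hR : ‖Rem‖ ≤ ε ^ 2 / 2 := norm_farF_farXi0_sub_le hz hε0 hε
  have hH0l := le_re_farH0 hz
  have hH0u := re_farH0_le hz
  have hH1 := norm_farH1_le hz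
  have e : (farF (farW z) ε (farXi0 (farW z) ε)).re + 1 =
      ((z - Complex.log (1 + z)) / (1 + z)).re +
        ε * (Complex.log (1 + z) ^ 2 * ((1 + z)⁻¹ / 8 - (1 + z)⁻¹ ^ 2 / 4)).re + Rem.re := by
    have := congrArg Complex.re hRem
    simp only [Complex.sub_re, Complex.add_re, Complex.one_re, Complex.re_ofReal_mul] at this
    linarith
  have hRr : |Rem.re| ≤ ε ^ 2 / 2 := (Complex.abs_re_le_norm _).trans hR
  have hH1r : |(Complex.log (1 + z) ^ 2 * ((1 + z)⁻¹ / 8 - (1 + z)⁻¹ ^ 2 / 4)).re| ≤ 11 / 50 :=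
    (Complex.abs_re_le_norm _).trans hH1
  obtain ⟨hRr1, hRr2⟩ := abs_le.1 hRr
  obtain ⟨hH1r1, hH1r2⟩ := abs_le.1 hH1r
  rw [e]
  constructor <;> nlinarith

/-- **The profile budget**: for `‖z‖ ≤ 3502/10000`, `0 < ε ≤ 20/189` and real `c₂ = −1/2 + ε/4 − ε²/16`,
`c₃ = 1/3 − 5ε/12 + ε²/4`:
`Re[Log(1+z) + (ε/2)(f(ξ₀)+1) − (z + c₂z² + c₃z³)] ≤ 1/150`. -/
theorem re_farProfile_le {z : ℂ} (hz : ‖z‖ ≤ (3502 / 10000 : ℝ)) {ε : ℝ} (hε0 : 0 < ε) (hε : ε ≤ 20 / 189) :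
    (Complex.log (1 + z)).re + ε / 2 * ((farF (farW z) ε (farXi0 (farW z) ε)).re + 1) -
        (z + (((-1 / 2 + ε / 4 - ε ^ 2 / 16 : ℝ)) : ℂ) * z ^ 2 + (((1 / 3 - 5 * ε / 12 + ε ^ 2 / 4 : ℝ)) : ℂ) * z ^ 3).re ≤
      1 / 150 := by
  set L := Complex.log (1 + z) with hL
  set f1 := farF (farW z) ε (farXi0 (farW z) ε) + 1 with hf1
  set G0 := (z - L) / (1 + z) with hG0
  set G1 := L ^ 2 * ((1 + z)⁻¹ / 8 - (1 + z)⁻¹ ^ 2 / 4) with hG1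
  set Rem := f1 - G0 - (ε : ℂ) * G1 with hRem
  have hR : ‖Rem‖ ≤ ε ^ 2 / 2 := by
    have := norm_farF_farXi0_sub_le hz hε0 hε
    rw [hRem, hf1, hG0, hG1, hL]
    convert this using 2
  have h0 := re_log_sub_cubic_le hz
  have h1 := re_farH0_profile_le hz
  have h2 := re_farH1_profile_le hz
  rw [← hL] at h0 h1 h2
  rw [← hG0] at h1
  rw [← hG1] at h2
  -- the complex decomposition
  have e : L + ((ε / 2 : ℝ) : ℂ) * f1 -
      (z + (((-1 / 2 + ε / 4 - ε ^ 2 / 16 : ℝ)) : ℂ) * z ^ 2 + (((1 / 3 - 5 * ε / 12 + ε ^ 2 / 4 : ℝ)) : ℂ) * z ^ 3) =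
      (L - (z - z ^ 2 / 2 + z ^ 3 / 3)) + ((ε / 2 : ℝ) : ℂ) * (G0 - (z ^ 2 / 2 - 5 * z ^ 3 / 6)) +
        ((ε ^ 2 / 2 : ℝ) : ℂ) * (G1 - (-z ^ 2 / 8 + z ^ 3 / 2)) + ((ε / 2 : ℝ) : ℂ) * Rem := by
    rw [hRem]; push_cast; ring
  have hre : (L + ((ε / 2 : ℝ) : ℂ) * f1 -
      (z + (((-1 / 2 + ε / 4 - ε ^ 2 / 16 : ℝ)) : ℂ) * z ^ 2 +
        (((1 / 3 - 5 * ε / 12 + ε ^ 2 / 4 : ℝ)) : ℂ) * z ^ 3)).re =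
      (L - (z - z ^ 2 / 2 + z ^ 3 / 3)).re + ε / 2 * (G0 - (z ^ 2 / 2 - 5 * z ^ 3 / 6)).re +
        ε ^ 2 / 2 * (G1 - (-z ^ 2 / 8 + z ^ 3 / 2)).re + ε / 2 * Rem.re := by
    rw [e]; simp only [Complex.add_re, Complex.re_ofReal_mul]
  have hlhs : L.re + ε / 2 * f1.re -
      (z + (((-1 / 2 + ε / 4 - ε ^ 2 / 16 : ℝ)) : ℂ) * z ^ 2 + (((1 / 3 - 5 * ε / 12 + ε ^ 2 / 4 : ℝ)) : ℂ) * z ^ 3).re =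
      (L + ((ε / 2 : ℝ) : ℂ) * f1 -
        (z + (((-1 / 2 + ε / 4 - ε ^ 2 / 16 : ℝ)) : ℂ) * z ^ 2 +
          (((1 / 3 - 5 * ε / 12 + ε ^ 2 / 4 : ℝ)) : ℂ) * z ^ 3)).re := by
    simp only [Complex.add_re, Complex.sub_re, Complex.re_ofReal_mul]
  have hf1re : f1.re = (farF (farW z) ε (farXi0 (farW z) ε)).re + 1 := by
    rw [hf1, Complex.add_re, Complex.one_re]
  rw [← hf1re, hlhs, hre]
  have hRr : Rem.re ≤ ε ^ 2 / 2 := (Complex.re_le_norm _).trans hR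
  have hε2 : ε ^ 2 ≤ (20 / 189) ^ 2 := pow_le_pow_left₀ hε0.le hε 2
  have hε3 : ε ^ 3 ≤ (20 / 189) ^ 3 := pow_le_pow_left₀ hε0.le hε 3
  nlinarith [mul_le_mul_of_nonneg_left h1 (by positivity : (0:ℝ) ≤ ε / 2),
    mul_le_mul_of_nonneg_left h2 (by positivity : (0:ℝ) ≤ ε ^ 2 / 2),
    mul_le_mul_of_nonneg_left hRr (by positivity : (0:ℝ) ≤ ε / 2)]

/-! ## 2. The stub -/

/-- `Λ = πe^{4υ} ≥ 2000` at the far mode (`υ ≥ 189/20`; `e^{x} ≥ 1 + x + x²/2`). -/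
theorem farLam_ge {υ : ℝ} (hυ : (189 / 20 : ℝ) ≤ υ) : 2000 ≤ farLam υ := by
  unfold farLam
  have h1 : (1 : ℝ) + 4 * υ + (4 * υ) ^ 2 / 2 ≤ Real.exp (4 * υ) := Real.quadratic_le_exp_of_nonneg (by linarith)
  have h2 : (700 : ℝ) ≤ Real.exp (4 * υ) := by nlinarith
  nlinarith [Real.pi_gt_three]

/-- The mode equation in the form used by the composition: `Λ = (M − ½)ε/2 + ε/4 + 9/4`, `ε = 1/υ`. -/
theorem farLam_eq_of_mode {M : ℕ} {υ : ℝ} (hυ : (189 / 20 : ℝ) ≤ υ)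
    (h : 4 * Real.pi * Real.exp (4 * υ) * υ = 2 * (M : ℝ) + 9 * υ) :
    farLam υ = ((M : ℝ) - 1 / 2) * (1 / υ) / 2 + (1 / υ) / 4 + 9 / 4 := by
  unfold farLam
  have hυ0 : υ ≠ 0 := by linarith
  field_simp
  linarith [h]

/-- `farMain M υ 0 = farL0 M υ` (`w = 1`, `ξ₀ = 0`, `f(0; 1, ε) = −1`). -/
theorem farMain_zero (M : ℕ) (υ : ℝ) : farMain M υ 0 = farL0 M υ := by
  unfold farMain farW farXi0 farF
  simp

/-- **Stub S4 `stub_elementary` of the far-Gumbel line (v3), PROVED.** -/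
theorem stub_elementary : ∀ M : ℕ, 2 * 10 ^ 18 ≤ M → ∀ υ : ℝ,
      ((189 / 20 : ℝ) ≤ υ ∧ 4 * Real.pi * Real.exp (4 * υ) * υ = 2 * (M : ℝ) + 9 * υ) →
      ∀ z : ℂ, ‖z‖ ≤ (3502 / 10000 : ℝ) →
      Real.log (farEnv M υ z) + 2 ≤ farMain M υ z - (farLam υ / υ ^ 3 + 6) ∧
      farMain M υ z - farMain M υ 0 - farCubic M υ z ≤ ((M : ℝ) - 1 / 2) / 150 + 1 := by
  intro M hM υ hυ z hz
  obtain ⟨hυ, hmode⟩ := hυ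
  have hυ0 : 0 < υ := by linarith
  set ε : ℝ := 1 / υ with hεdef
  have hε0 : 0 < ε := by rw [hεdef]; positivity
  have hε : ε ≤ 20 / 189 := by
    rw [hεdef, div_le_iff₀ hυ0]; nlinarith
  have hΛ := farLam_ge hυ
  have hΛeq := farLam_eq_of_mode hυ hmode
  rw [← hεdef] at hΛeq
  have hMpos : (0 : ℝ) < (M : ℝ) - 1 / 2 := by
    have : (2 * 10 ^ 18 : ℝ) ≤ (M : ℝ) := by exact_mod_cast hM
    linarith
  -- the norm of `1 + z` and of `w`
  obtain ⟨h1z0, -⟩ := norm_inv_one_add_le hz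
  have h1zpos : 0 < ‖1 + z‖ := norm_pos_iff.2 h1z0
  have h1zlo : (6498 : ℝ) / 10000 ≤ ‖1 + z‖ := by
    have h := norm_sub_le (1 + z) z
    simp only [add_sub_cancel_right, norm_one] at h
    linarith
  have h1zhi : ‖1 + z‖ ≤ 13502 / 10000 := by
    have h := norm_add_le (1 : ℂ) z
    rw [norm_one] at h; linarith
  have hlogw : Real.log ‖farW z‖ = -Real.log ‖1 + z‖ := by
    unfold farW; rw [norm_inv, Real.log_inv]
  have hlog1z_hi : Real.log ‖1 + z‖ ≤ 3502 / 10000 := by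
    have := Real.log_le_sub_one_of_pos h1zpos; linarith
  have hlog1z_lo : -(11 : ℝ) / 20 ≤ Real.log ‖1 + z‖ := by
    -- `log x ≥ 1 − 1/x` and `1/x ≤ 10000/6498`
    have h := Real.one_sub_inv_le_log_of_pos h1zpos
    have hinv : (‖1 + z‖)⁻¹ ≤ (6498 / 10000 : ℝ)⁻¹ := inv_anti₀ (by norm_num) h1zlo
    norm_num at hinv
    linarith
  -- `Re f + 1` two-sided
  obtain ⟨hFlo, hFhi⟩ := re_farF_add_one_bounds hz hε0 hε
  have hε2 : ε ^ 2 ≤ (20 / 189) ^ 2 := pow_le_pow_left₀ hε0.le hε 2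
  have hε3 : ε ^ 3 ≤ (20 / 189) ^ 3 := pow_le_pow_left₀ hε0.le hε 3
  constructor
  · -- (i) the envelope
    have hEnv : Real.log (farEnv M υ z) = farL0 M υ + ((M : ℝ) - 1 / 2) * Real.log ‖1 + z‖ - farLam υ / 8 := by
      unfold farEnv
      rw [Real.log_mul (by positivity) (by positivity), Real.log_mul (by positivity) (by positivity),
        Real.log_exp, Real.log_exp, Real.log_rpow h1zpos]
      ring
    rw [hEnv]
    unfold farMain
    rw [hlogw, ← hεdef]
    set F := (farF (farW z) ε (farXi0 (farW z) ε)).re + 1 with hFdef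
    have hυ3 : farLam υ / υ ^ 3 = farLam υ * ε ^ 3 := by rw [hεdef]; field_simp
    rw [hυ3]
    -- `Λ·(F + 1/8 − ε³) + ½ log‖1+z‖ − 8 ≥ 0`
    have hkey : (1 : ℝ) / 60 ≤ F + 1 / 8 - ε ^ 3 := by nlinarith
    have hΛ0 : 0 ≤ farLam υ := by linarith
    nlinarith [mul_le_mul_of_nonneg_left hkey hΛ0]
  · -- (ii) the profile
    have hprof := re_farProfile_le hz hε0 hε
    rw [Complex.log_re] at hprof
    rw [farMain_zero]
    unfold farMain farCubic
    rw [hlogw, hΛeq, ← hεdef]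
    have hcubic : (z + (((-1 / 2 + 1 / (4 * υ) - 1 / (16 * υ ^ 2) : ℝ)) : ℂ) * z ^ 2 +
        (((1 / 3 - 5 / (12 * υ) + 1 / (4 * υ ^ 2) : ℝ)) : ℂ) * z ^ 3).re =
        (z + (((-1 / 2 + ε / 4 - ε ^ 2 / 16 : ℝ)) : ℂ) * z ^ 2 +
          (((1 / 3 - 5 * ε / 12 + ε ^ 2 / 4 : ℝ)) : ℂ) * z ^ 3).re := by
      have e1 : (-1 / 2 + 1 / (4 * υ) - 1 / (16 * υ ^ 2) : ℝ) = -1 / 2 + ε / 4 - ε ^ 2 / 16 := by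
        rw [hεdef]; field_simp
      have e2 : (1 / 3 - 5 / (12 * υ) + 1 / (4 * υ ^ 2) : ℝ) = 1 / 3 - 5 * ε / 12 + ε ^ 2 / 4 := by
        rw [hεdef]; field_simp
      rw [e1, e2]
    rw [hcubic]
    set F := (farF (farW z) ε (farXi0 (farW z) ε)).re + 1 with hFdef
    have hO1 : (ε / 4 + 9 / 4) * F + 1 / 2 * Real.log ‖1 + z‖ ≤ 1 := by nlinarith
    nlinarith [mul_le_mul_of_nonneg_left hprof hMpos.le]

end Summit.RiemannHypothesis.RiemannHypothesis.Theorems.JensenPolynomials.FarGumbel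

end
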